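import Literature.Geometry.Lorentzian.MGHDUniqueness
import Literature.Geometry.Lorentzian.OpensCausality
import Literature.Geometry.Lorentzian.CauchyDevelopmentRestrict
import Literature.Geometry.Lorentzian.InitialDataPullback

/-!
# Route SwallowTheDatum · item `SubdataDevelopmentsEmbed` (stmt-FinalStateConjecture-10053) —
# hypothesis (3) of the skeleton ("a maximal relative common sub-development of a MAXIMAL
# development is everything") from its two printed ingredients: NO CORRESPONDING BOUNDARY POINTS
# (Sbierski 2016, Thm. 3.5) and the GLUING (Sbierski 2016, §3.2–3.3; Choquet-Bruhat–Geroch 1969,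
# pp. 333–334)

`subdataDevelopmentsEmbed_of_skeleton` (`…SubdataDevelopmentsEmbedSkeleton.lean`) proves the item
from three hypotheses; the third, `hmax`, says: if `𝒟` is a maximal vacuum Cauchy development of
`D`, `𝒟'` one of `D.comap Φ`, and `(U, ψ)` a relative common sub-development of `𝒟'` and `𝒟` over
`Φ` admitting no proper extension, then `U = M'`. In print this is two steps, displayed here as
hypotheses of `hmax_of_noCorrespondingBoundary_of_gluing`:

* `hncb` — **a maximal relative common sub-development has no corresponding boundary points**
  (Sbierski 2016, Thm. 3.5 = arXiv Thm. 12, relative form): no point `q ∈ M` is a cluster point of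
  `ψ` along `U` at a boundary point `p ∈ ∂U` (`ClusterPt q (map ψ (𝓝[U] p))`; Sbierski, Def. 3.4 /
  Prop. 3.6). Its proof is where LOCAL GEOMETRIC UNIQUENESS enters a second time (on an auxiliary
  spacelike disc through `p`), with exponential-map / convex-neighbourhood causality theory.
* `hglue` — **gluing**: without corresponding boundary points the pushout `M ∪_ψ M'` is a vacuum
  Cauchy development `Z` of `D` into which `𝒟` embeds (by `jZ`) and `𝒟'` maps by a smooth,
  isometric, time-orientation preserving open embedding `j'` over `Φ` with `j' = jZ ∘ ψ` on `U`
  (Hausdorff because of `hncb`; `ι(X)` remains a Cauchy hypersurface; Sbierski 2016, proof of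
  Thm. 3.7 and §3.3; Choquet-Bruhat–Geroch 1969, pp. 333–334; Hawking–Ellis 1973, pp. 250–251).

Given these, maximality of `𝒟` yields `θ : Z → 𝒟` over `ι`; `θ ∘ jZ = id` by rigidity of data
embeddings (`DataEmbedding.eq_id_of_comp_embed_eq'`, `MGHDUniqueness.lean`), so `θ ∘ j'` is a
relative common sub-development on ALL of `M'` extending `(U, ψ)`, and the no-proper-extension
property forces `U = ⊤`. Pure logic over the prelude plus that rigidity theorem; no definition,
no named fact.
-/

noncomputable section

open Function Set Filter Topology TopologicalSpace
open scoped Manifold ContDiff Topology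

namespace Summit.FinalStateConjecture.FinalStateConjecture.Theorems

namespace SubdataDevelopmentsEmbed

open Literature.Geometry.Lorentzian

universe u v

variable {n : ℕ}
  {N : Type u} [TopologicalSpace N] [ChartedSpace (EuclideanSpace ℝ (Fin n)) N]
  [IsManifold (𝓡 n) ∞ N] [ConnectedSpace N] {D₁ : InitialDataSet (𝓡 n) N}
  {X : Type v} [TopologicalSpace X] [ChartedSpace (EuclideanSpace ℝ (Fin n)) X]
  [IsManifold (𝓡 n) ∞ X] [ConnectedSpace X] {D₂ : InitialDataSet (𝓡 n) X}

/-- **`hmax` from "no corresponding boundary points" and "gluing".** Let `𝒟'` be a Cauchy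
development of data `D₁` on `N`, `𝒟` a MAXIMAL vacuum Cauchy development of data `D₂` on `X`,
`Φ : N → X`, and `(U, ψ)` (`U ⊆ M'` open, `ψ : M' → M`) admitting no proper extension among the
relative common sub-developments of `𝒟'` and `𝒟` over `Φ` (`hUmax`; that `(U, ψ)` is itself one is
not even needed for this step). Suppose (`hglue`, to which the absence of
corresponding boundary points `hncb` is fed) there are a vacuum Cauchy development `Z` of `D₂`, an
embedding `jZ : 𝒟 → Z` of developments and a smooth isometric time-orientation preserving open
embedding `j' : M' → Z` over `Φ` with `j' = jZ ∘ ψ` on `U` — the glued development `M ∪_ψ M'`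
(Sbierski 2016, §3.2–3.3; Choquet-Bruhat–Geroch 1969, pp. 333–334). Then `U = M'`: maximality of
`𝒟` gives `θ : Z → 𝒟` over `ι`, `θ ∘ jZ = id` (rigidity, `DataEmbedding.eq_id_of_comp_embed_eq'`),
so `(M', θ ∘ j')` is a relative common sub-development extending `(U, ψ)`.
[cite: Sbierski2016AHP, Thm. 3.5 and §3.3] -/
theorem top_of_noCorrespondingBoundary_of_gluing (𝒟' : CauchyDevelopment D₁)
    (𝒟 : VacuumCauchyDevelopment.{v} D₂) (h𝒟 : 𝒟.IsMaximal) (Φ : N → X)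
    (U : Opens 𝒟'.carrier) (ψ : 𝒟'.carrier → 𝒟.carrier)
    (hUmax : ∀ (U' : Opens 𝒟'.carrier) (ψ' : 𝒟'.carrier → 𝒟.carrier),
      ((∀ u, 𝒟'.embed u ∈ U') ∧ IsConnected (U' : Set 𝒟'.carrier) ∧
      (𝒟'.metric.restrict PseudoRiemannianMetric.contMDiff_restrict_holds U').IsCauchyHypersurface
        (𝒟'.timeOrientation.restrict PseudoRiemannianMetric.contMDiff_restrict_holds
          𝒟'.timeOrientation.contMDiff_restrict_holds U') (Subtype.val ⁻¹' range 𝒟'.embed) ∧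
      ContMDiffOn (𝓡 (n + 1)) (𝓡 (n + 1)) ∞ ψ' U' ∧
      (∀ p ∈ U', pullbackBilin (I := 𝓡 (n + 1)) (I' := 𝓡 (n + 1)) ψ' 𝒟.metric.val p =
        𝒟'.metric.val p) ∧
      (∀ p ∈ U', 𝒟.timeOrientation.IsFutureDirected
        (mfderiv (𝓡 (n + 1)) (𝓡 (n + 1)) ψ' p (𝒟'.timeOrientation.vectorField p))) ∧
      ψ' ∘ 𝒟'.embed = 𝒟.embed ∘ Φ) →
      U ≤ U' → EqOn ψ ψ' U → U' = U)
    (hglue : ∃ (Z : VacuumCauchyDevelopment.{v} D₂) (jZ : 𝒟.carrier → Z.carrier)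
        (j' : 𝒟'.carrier → Z.carrier),
      (ContMDiff (𝓡 (n + 1)) (𝓡 (n + 1)) ∞ jZ ∧ IsOpenEmbedding jZ ∧
        𝒟.metric.IsIsometricImmersion Z.metric.toPseudoRiemannianMetric jZ ∧
        𝒟.timeOrientation.PreservesTimeOrientation jZ Z.timeOrientation ∧
        jZ ∘ 𝒟.embed = Z.embed) ∧
      (ContMDiff (𝓡 (n + 1)) (𝓡 (n + 1)) ∞ j' ∧ IsOpenEmbedding j' ∧
        𝒟'.metric.IsIsometricImmersion Z.metric.toPseudoRiemannianMetric j' ∧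
        𝒟'.timeOrientation.PreservesTimeOrientation j' Z.timeOrientation ∧
        j' ∘ 𝒟'.embed = Z.embed ∘ Φ) ∧
      ∀ x ∈ U, j' x = jZ (ψ x)) :
    U = ⊤ := by
  obtain ⟨Z, jZ, j', ⟨hjZs, hjZo, hjZi, hjZt, hjZc⟩, ⟨hj's, hj'o, hj'i, hj't, hj'c⟩, hcompat⟩ := hglue
  -- maximality of `𝒟`: `Z` embeds back into `𝒟`
  obtain ⟨θ, hθs, hθo, hθi, hθt, hθc⟩ := h𝒟 Z
  have hθd : MDifferentiable (𝓡 (n + 1)) (𝓡 (n + 1)) θ := hθs.mdifferentiable (by simp)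
  have hjZd : MDifferentiable (𝓡 (n + 1)) (𝓡 (n + 1)) jZ := hjZs.mdifferentiable (by simp)
  have hj'd : MDifferentiable (𝓡 (n + 1)) (𝓡 (n + 1)) j' := hj's.mdifferentiable (by simp)
  -- rigidity: `θ ∘ jZ = id`
  have hid : θ ∘ jZ = id :=
    𝒟.toDataEmbedding.eq_id_of_comp_embed_eq' (hθi.comp hjZi)
      (hθt.comp hjZt hθi.2 hθd hjZd) (by rw [comp_assoc, hjZc, hθc])
  -- the relative common sub-development `(⊤, θ ∘ j')` extends `(U, ψ)`
  have hext : EqOn ψ (θ ∘ j') (U : Set 𝒟'.carrier) := fun x hx ↦ by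
    rw [comp_apply, hcompat x hx, ← comp_apply (f := θ) (g := jZ), hid, id]
  refine (hUmax ⊤ (θ ∘ j') ⟨fun u ↦ trivial, ?_, ?_, ?_, ?_, ?_, ?_⟩ le_top hext).symm
  · -- `M'` is connected
    simpa using isConnected_univ (α := 𝒟'.carrier)
  · -- `ι'(N)` is a Cauchy hypersurface of the sub-spacetime `⊤ = M'`: transport from `U`? No —
    -- directly: it is a Cauchy hypersurface of `M'`, and `⊤` is all of `M'`.
    intro γ s hγ
    have hγ' : 𝒟'.metric.IsEndlessTimelikeCurve 𝒟'.timeOrientation (Subtype.val ∘ γ) s := by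
      refine ⟨hγ.1, (LorentzianMetric.isFutureTimelikeCurveOn_restrict_iff 𝒟'.metric
        𝒟'.timeOrientation PseudoRiemannianMetric.contMDiff_restrict_holds
        𝒟'.timeOrientation.contMDiff_restrict_holds _).1 hγ.2.1, ?_, ?_⟩
      · refine ⟨hγ.2.2.1.1, fun q hq ↦ hγ.2.2.1.2 ⟨q, trivial⟩ ?_⟩
        exact hasFutureEndpoint_subtypeVal_comp_iff.1 hq
      · refine ⟨hγ.2.2.2.1, fun q hq ↦ hγ.2.2.2.2 ⟨q, trivial⟩ ?_⟩
        exact hasPastEndpoint_subtypeVal_comp_iff.1 hq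
    obtain ⟨t, ht, huniq⟩ := 𝒟'.isCauchyHypersurface _ s hγ'
    exact ⟨t, ht, huniq⟩
  · -- smooth on `⊤`
    exact (hθs.comp hj's).contMDiffOn
  · -- isometric on `⊤`
    intro p _
    have h := (hθi.comp hj'i).2 p
    exact h
  · -- time-orientation preserving on `⊤`
    intro p _
    exact (hθt.comp hj't hθi.2 hθd hj'd) p
  · -- `(θ ∘ j') ∘ ι' = θ ∘ ι_Z ∘ Φ = ι ∘ Φ`
    rw [comp_assoc, hj'c, ← comp_assoc, hθc]

/-- **`hmax` of the skeleton, decomposed**: for a relative common sub-development `(U, ψ)` of `𝒟'`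
and a MAXIMAL `𝒟` over `Φ` with no proper extension, `U = M'` follows from
(i) `hncb`: such a maximal `(U, ψ)` has NO CORRESPONDING BOUNDARY POINTS — no `q ∈ M` is a cluster
point of `ψ` along `U` at a point `p` of the frontier of `U` (Sbierski 2016, Def. 3.4 and Thm. 3.5
= arXiv Def. 11 / Thm. 12, relative form; uses local geometric uniqueness on auxiliary spacelike
discs), and (ii) `hglue`: without corresponding boundary points the pushout `M ∪_ψ M'` is a vacuum
Cauchy development `Z` of `D₂` receiving `𝒟` (embedding `jZ`) and `𝒟'` (open embedding `j'` over
`Φ`, `j' = jZ ∘ ψ` on `U`) (Sbierski 2016, §3.2–3.3; Choquet-Bruhat–Geroch 1969, pp. 333–334;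
Hawking–Ellis 1973, pp. 250–251) — via `top_of_noCorrespondingBoundary_of_gluing`. This displays
the two remaining constructions behind hypothesis (3) of `subdataDevelopmentsEmbed_of_skeleton`.
[cite: Sbierski2016AHP, Def. 3.4, Thm. 3.5 and §3.3] -/
theorem top_of_maximal_relCGHD (𝒟' : CauchyDevelopment D₁)
    (𝒟 : VacuumCauchyDevelopment.{v} D₂) (h𝒟 : 𝒟.IsMaximal) (Φ : N → X)
    (U : Opens 𝒟'.carrier) (ψ : 𝒟'.carrier → 𝒟.carrier)
    (hP : (∀ u, 𝒟'.embed u ∈ U) ∧ IsConnected (U : Set 𝒟'.carrier) ∧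
      (𝒟'.metric.restrict PseudoRiemannianMetric.contMDiff_restrict_holds U).IsCauchyHypersurface
        (𝒟'.timeOrientation.restrict PseudoRiemannianMetric.contMDiff_restrict_holds
          𝒟'.timeOrientation.contMDiff_restrict_holds U) (Subtype.val ⁻¹' range 𝒟'.embed) ∧
      ContMDiffOn (𝓡 (n + 1)) (𝓡 (n + 1)) ∞ ψ U ∧
      (∀ p ∈ U, pullbackBilin (I := 𝓡 (n + 1)) (I' := 𝓡 (n + 1)) ψ 𝒟.metric.val p =
        𝒟'.metric.val p) ∧
      (∀ p ∈ U, 𝒟.timeOrientation.IsFutureDirected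
        (mfderiv (𝓡 (n + 1)) (𝓡 (n + 1)) ψ p (𝒟'.timeOrientation.vectorField p))) ∧
      ψ ∘ 𝒟'.embed = 𝒟.embed ∘ Φ)
    (hUmax : ∀ (U' : Opens 𝒟'.carrier) (ψ' : 𝒟'.carrier → 𝒟.carrier),
      ((∀ u, 𝒟'.embed u ∈ U') ∧ IsConnected (U' : Set 𝒟'.carrier) ∧
      (𝒟'.metric.restrict PseudoRiemannianMetric.contMDiff_restrict_holds U').IsCauchyHypersurface
        (𝒟'.timeOrientation.restrict PseudoRiemannianMetric.contMDiff_restrict_holds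
          𝒟'.timeOrientation.contMDiff_restrict_holds U') (Subtype.val ⁻¹' range 𝒟'.embed) ∧
      ContMDiffOn (𝓡 (n + 1)) (𝓡 (n + 1)) ∞ ψ' U' ∧
      (∀ p ∈ U', pullbackBilin (I := 𝓡 (n + 1)) (I' := 𝓡 (n + 1)) ψ' 𝒟.metric.val p =
        𝒟'.metric.val p) ∧
      (∀ p ∈ U', 𝒟.timeOrientation.IsFutureDirected
        (mfderiv (𝓡 (n + 1)) (𝓡 (n + 1)) ψ' p (𝒟'.timeOrientation.vectorField p))) ∧
      ψ' ∘ 𝒟'.embed = 𝒟.embed ∘ Φ) →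
      U ≤ U' → EqOn ψ ψ' U → U' = U)
    (hncb : ((∀ u, 𝒟'.embed u ∈ U) ∧ IsConnected (U : Set 𝒟'.carrier) ∧
      (𝒟'.metric.restrict PseudoRiemannianMetric.contMDiff_restrict_holds U).IsCauchyHypersurface
        (𝒟'.timeOrientation.restrict PseudoRiemannianMetric.contMDiff_restrict_holds
          𝒟'.timeOrientation.contMDiff_restrict_holds U) (Subtype.val ⁻¹' range 𝒟'.embed) ∧
      ContMDiffOn (𝓡 (n + 1)) (𝓡 (n + 1)) ∞ ψ U ∧
      (∀ p ∈ U, pullbackBilin (I := 𝓡 (n + 1)) (I' := 𝓡 (n + 1)) ψ 𝒟.metric.val p =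
        𝒟'.metric.val p) ∧
      (∀ p ∈ U, 𝒟.timeOrientation.IsFutureDirected
        (mfderiv (𝓡 (n + 1)) (𝓡 (n + 1)) ψ p (𝒟'.timeOrientation.vectorField p))) ∧
      ψ ∘ 𝒟'.embed = 𝒟.embed ∘ Φ) →
      (∀ (U' : Opens 𝒟'.carrier) (ψ' : 𝒟'.carrier → 𝒟.carrier),
      ((∀ u, 𝒟'.embed u ∈ U') ∧ IsConnected (U' : Set 𝒟'.carrier) ∧
      (𝒟'.metric.restrict PseudoRiemannianMetric.contMDiff_restrict_holds U').IsCauchyHypersurface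
        (𝒟'.timeOrientation.restrict PseudoRiemannianMetric.contMDiff_restrict_holds
          𝒟'.timeOrientation.contMDiff_restrict_holds U') (Subtype.val ⁻¹' range 𝒟'.embed) ∧
      ContMDiffOn (𝓡 (n + 1)) (𝓡 (n + 1)) ∞ ψ' U' ∧
      (∀ p ∈ U', pullbackBilin (I := 𝓡 (n + 1)) (I' := 𝓡 (n + 1)) ψ' 𝒟.metric.val p =
        𝒟'.metric.val p) ∧
      (∀ p ∈ U', 𝒟.timeOrientation.IsFutureDirected
        (mfderiv (𝓡 (n + 1)) (𝓡 (n + 1)) ψ' p (𝒟'.timeOrientation.vectorField p))) ∧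
      ψ' ∘ 𝒟'.embed = 𝒟.embed ∘ Φ) →
      U ≤ U' → EqOn ψ ψ' U → U' = U) →
      (∀ p ∈ frontier (U : Set 𝒟'.carrier), ∀ q : 𝒟.carrier,
        ¬ ClusterPt q (map ψ (𝓝[(U : Set 𝒟'.carrier)] p))))
    (hglue : ((∀ u, 𝒟'.embed u ∈ U) ∧ IsConnected (U : Set 𝒟'.carrier) ∧
      (𝒟'.metric.restrict PseudoRiemannianMetric.contMDiff_restrict_holds U).IsCauchyHypersurface
        (𝒟'.timeOrientation.restrict PseudoRiemannianMetric.contMDiff_restrict_holds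
          𝒟'.timeOrientation.contMDiff_restrict_holds U) (Subtype.val ⁻¹' range 𝒟'.embed) ∧
      ContMDiffOn (𝓡 (n + 1)) (𝓡 (n + 1)) ∞ ψ U ∧
      (∀ p ∈ U, pullbackBilin (I := 𝓡 (n + 1)) (I' := 𝓡 (n + 1)) ψ 𝒟.metric.val p =
        𝒟'.metric.val p) ∧
      (∀ p ∈ U, 𝒟.timeOrientation.IsFutureDirected
        (mfderiv (𝓡 (n + 1)) (𝓡 (n + 1)) ψ p (𝒟'.timeOrientation.vectorField p))) ∧
      ψ ∘ 𝒟'.embed = 𝒟.embed ∘ Φ) →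
      (∀ p ∈ frontier (U : Set 𝒟'.carrier), ∀ q : 𝒟.carrier,
        ¬ ClusterPt q (map ψ (𝓝[(U : Set 𝒟'.carrier)] p))) →
      ∃ (Z : VacuumCauchyDevelopment.{v} D₂) (jZ : 𝒟.carrier → Z.carrier)
        (j' : 𝒟'.carrier → Z.carrier),
      (ContMDiff (𝓡 (n + 1)) (𝓡 (n + 1)) ∞ jZ ∧ IsOpenEmbedding jZ ∧
        𝒟.metric.IsIsometricImmersion Z.metric.toPseudoRiemannianMetric jZ ∧
        𝒟.timeOrientation.PreservesTimeOrientation jZ Z.timeOrientation ∧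
        jZ ∘ 𝒟.embed = Z.embed) ∧
      (ContMDiff (𝓡 (n + 1)) (𝓡 (n + 1)) ∞ j' ∧ IsOpenEmbedding j' ∧
        𝒟'.metric.IsIsometricImmersion Z.metric.toPseudoRiemannianMetric j' ∧
        𝒟'.timeOrientation.PreservesTimeOrientation j' Z.timeOrientation ∧
        j' ∘ 𝒟'.embed = Z.embed ∘ Φ) ∧
      ∀ x ∈ U, j' x = jZ (ψ x)) :
    U = ⊤ := by
  exact top_of_noCorrespondingBoundary_of_gluing 𝒟' 𝒟 h𝒟 Φ U ψ hUmax (hglue hP (hncb hP hUmax))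

end SubdataDevelopmentsEmbed

end Summit.FinalStateConjecture.FinalStateConjecture.Theorems

end
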